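import Summits.QuantumFields.YangMills.Theorems.SkewnessNonGeneration.Negative.DilationCovariance
import Summits.QuantumFields.YangMills.Theorems.SkewnessNonGeneration.Negative.CompanionFree
import Summits.QuantumFields.YangMills.Theorems.SkewnessNonGeneration.Negative.Slices
import Summits.QuantumFields.YangMills.Theorems.SkewnessNonGeneration.Negative.ZeroCoupling
import Summits.QuantumFields.YangMills.Theorems.SkewnessNonGeneration.Negative.MassiveGaussianFoil
import Summits.QuantumFields.YangMills.Theorems.SkewnessNonGeneration.Negative.MassiveGaussianFoilObstruction

/-!
# Disproof of `SkewnessNonGeneration` — findings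

Crux K2 of route `BoundedSkewnessRunning` (item `stmt-QuantumFields-19896`), a REFUTATION route
(`closes : K1 → K2 → S1 → S2 → S3 → ¬ YangMills`).  K2 says: for `G = SU(2)`, a weakly coupled,
uniformly gapped scheme `sch` with an admissible RP window `u`, and a companion `sch'` (same `β`, `L`,
`a ≤ a'`, `(a')⁻¹ ≤ β^κ` eventually) along which the self-normalised skewness `κ₃^canon` of `tr F²`
dies at ALL admissible data, the skewness dies along `sch` too.  Refuter seats
`refuter-ym-cdisprove-19896-1-g0-0` (2026-08-27, v1–v2) and `…-g1-0` (v3, this file).  Prose only in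
docstrings.  v4: EVERYTHING conclusive is LANDED under `Theorems/SkewnessNonGeneration/Negative/` and
imported here — `DilationCovariance` (p530625), `CompanionFree` (p532349) [g0]; `ZeroCoupling` (p540530),
`Slices` (p542162), and the bc5 seat's `MassiveGaussianFoil` (p543611) + `MassiveGaussianFoilObstruction`
(p545243) [filed by g1] — so this workfile is an INDEX: one `example` per finding re-deriving it from the
tree name, plus the one theorem kept here (`skewnessNonGeneration_constRatio`).

**Verdict (unchanged, sharpened): no unconditional kill is possible in the tree; none cheap is
plausible on paper; K2 is anti-consensus but `¬ K2` is Clay-hard.**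

1. *(structure; landed)* `latticeSchwinger` reads a scheme only through `(a_k, β_k, L_k, c, m)`;
   `sch` and a companion with the same `β, L` sample THE SAME Wilson measures through test functions
   dilated by `s_k = a'_k/a_k`, the bare `n`-point functions scale by `s^{-4n}`, `T_k` by `s⁻⁸`, and
   `κ₃^canon` is exactly dilation INVARIANT (`Negative.cruxKappa3_companion`):
   `κ₃^canon_k[sch](u;f,g,h) = κ₃^canon_k[sch'](D_{s_k}u; D_{s_k}f, D_{s_k}g, D_{s_k}h)`.
2. *(load-bearing; landed)* At CONSTANT ratio the companion is idle
   (`Negative.tendsto_cruxKappa3_of_constRatio`, `skewnessNonGeneration_constRatio` below): all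
   content of K2 is the regime `a_k/a'_k → 0` — K2 = "UV extinction along `sch'` is UNIFORM over the
   dilated family `D_λ(u,f,g,h)`, `λ ∈ (0,1]`"; only the gap can pay for that uniformity.
3. *(boundary; landed)* `T_k(u) ≤ 0 ⇒ κ₃^canon_k = 0` (`Negative.cruxKappa3_eq_zero_of_cruxT_nonpos`):
   a counterexample must keep `T_k(u) > 0` frequently.
4. *(normal form; landed)* Modulo K1, K2 ⟺ its companion-free form CF
   (`Negative.skewnessNonGeneration_iff_CF`) and `¬ K2 ⟺ SkewedGappedScheme`
   (`Negative.not_skewnessNonGeneration_iff`).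
5. *(slices; landed `Negative.Slices`)* `K2 ↔ ∀ κ ≥ 1, K2_κ` definitionally; the slices are ANTITONE in `κ`
   (`skewnessNonGenerationAt_anti`: a larger exponent admits more companions); and modulo K1 EVERY
   slice — already the weakest, `K2_1` — is equivalent to K2 and to CF (`skewnessNonGenerationAt_iff`):
   the `∀ κ` prefix, the companion and its four side conditions are all idle modulo K1.  (Planner
   information: restating K2 as CF loses nothing the route can use.)
6. *(load-bearing: `hw`; landed `Negative.Slices` §WeakCoupling, `Negative.ZeroCoupling`)* On ODD slices `hw` is decoration — the companion window
   and `a' → 0⁺` force `β_k^κ → +∞`, hence `β_k → +∞` (`hasWeakCouplingLimit_of_companion_odd`); on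
   EVEN slices it carries exactly the sign of `β` (`exists_evenWindow_not_hasWeakCouplingLimit`:
   `a_k = (k+1)⁻²`, `β_k = -(k+1)` sits in the `κ = 2` window).  Deleting `hw` opens NO junk
   refutation: the only uniformly gapped Wilson scheme constructible in the tree, zero coupling
   `β ≡ 0` (`hasLatticeMassGap_of_zero_coupling`), has `T_k(u) = 0` at every step for past-supported
   `u` (`cruxT_eq_zero_of_beta_zero`, kernel-checked from the tree's exact `β = 0` formula
   `latticeSchwinger_beta_zero`: off the diagonal the curvature is a c-number field and `u ⊗ Θu`
   vanishes on the diagonal), so it meets every hypothesis of K2 but `hw` (gap ∀Δ, window ∀M) AND the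
   conclusion (`zeroCoupling_meets_K2_sans_weakCoupling`).  K2 − `hw` could only fail at STRONG
   coupling `0 < β ≤ β₀` (cluster expansion: gap ✓, correlated plaquettes ✓ — not in the tree, and
   there the window `T_k(u) ≤ M T_k(τ₋₁u)` fails anyway: `m_lat(β₀)/a_k → ∞` makes the scheme
   ultra-massive, `T_k(u)/T_k(τ₋₁u) ~ e^{2 m_lat/a_k} → ∞`).
7. *(calibre; landed `Negative.Slices` §Calibre, unconditional)* `¬ K2 ⇒` a faithful `SU(2)` representation and a weakly
   coupled Wilson scheme with a UNIFORM LATTICE MASS GAP on all tori `S ≥ L_k`, an RP window with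
   `T_k(u) > 0` frequently, and a skewed admissible triple
   (`exists_gapped_skewed_of_not_skewnessNonGeneration`); in particular `¬ K2` contains
   `HasLatticeMassGap` at `β_k → ∞` (`exists_weakCouplingGap_of_not_skewnessNonGeneration`) — the
   lattice half of the Millennium problem (cf. `ClusteringToYangMills.Negative.
   su2_clustering_of_not_clusteringToYangMills` for the sister crux).  Every junk direction is closed:
   `G = SU(2)` hard-wired, `LatticeRep.injective`, `hw` (item 6), `T_k ≤ 0` collapse (item 3), and the
   conclusion of K2 is a "`→ 0`" statement, true on every extinct model.
8. *(regime analysis, on paper)* The three hypotheses on `sch` pin the physical correlation length: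
   the gap gives `m_phys ≥ Δ`; the window at shift `1` gives, heuristically, `m_phys ≲ ½ log M`
   (no ultra-massive escape — this is what kills finite-`G`/large-`β` contour-expansion models even
   if `G` were not hard-wired); `hw` forces `β_k → ∞`, so only an asymptotically free theory can sit
   in the window: the regime is the physical confinement scale, where the triple-glueball coupling is
   `G²/4π ≈ 40` (SU(2), SU(3); Montvay–Münster 1994 p.161 eq. (3.450); p.162 eq. (3.457) `60 ± 25`)
   and the NSVZ low-energy theorem forces a non-zero zero-momentum three-point function of `tr F²`
   (Ioffe–Fadin–Lipatov 2010 p.99 eq. (3.99)).  So K2 is ANTI-consensus, and its negation is the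
   consensus PLUS the lattice gap: neither side is reachable.  presearch: [corpus:montvay1994 p.161]
   triple glueball coupling from the on-shell three-plaquette vertex; galaxy "triple glueball
   coupling|three-plaquette vertex" → panama: Montvay–Münster only; vsearch (β = 0 independence of
   Haar links) → Oitmaa–Hamer–Zheng 2006 p.204 (strong-coupling series), folklore.
9. *(not filed as `--negative-modulo`)* `SkewedGappedScheme ∧ K1 → ¬ K2` is `closes` rearranged; the
   registered strong hypotheses (`LatticeMassGapAllCouplings`, `ChatterjeeMassGapProblem`,
   `ClayYangMillsEuclidean{,Along,Gap}`) live on other interfaces and a gap alone gives no lower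
   bound on a three-point function — no honest `H → ¬K2` with `H` short of the consensus exists.
10. `-- Targets`: BC3 plan stubs `stub_twoPointMaxwellLower`, `stub_bareSkewnessNonGeneration`,
   `stub_canonBareScaling` (no line picked, no lead, route dormant): none killed;
   `stub_canonBareScaling` is TRUE (cumulant shift/scale identity under a probability measure —
   prover's S1); the other two need the gapped weak-coupling scheme of item 7.
11. *(the MASSIVE GAUSSIAN FOIL — authored by the K1 bc5-witness seat `ym-bc5-19897-1` g1, checked and
   filed on this lane by g1 of this seat; LANDED p543611 `Negative/MassiveGaussianFoil.lean`
   (route-independent) and p545243 `Negative/MassiveGaussianFoilObstruction.lean`)*  In `d = 4`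
   the odd ring `tr K(h₁)K(h₂)K(h₃)` of a Gaussian 2-form — `⅛` of the third-cumulant density of the Wick
   square `F_{μν}F_{μν}` — consists of MASS INSERTIONS only (`massiveOddRing_eq`; the landed
   `treeLevelSkewness_vanishes` is the traceless = massless case) and is STRICTLY NEGATIVE on collinear
   triples for every radially non-increasing, strictly subharmonic kernel, e.g. the free massive propagator
   (`ΔD_m = m²D_m > 0`; `axisOddRing_neg`, `radialOddRing_collinear_neg`), with even ring `> 0`
   (`axisEvenRing_pos`).  So the K2-ANALOGUE («gapped ⇒ no `tr F²` skewness») is FALSE in every gapped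
   Gaussian(-dominated) 2-form model — the tribunal judge's «K2-analogue in any gapped model» decided
   adversely — and the only Gaussian 2-form with zero `F²`-skewness, massless Maxwell, has no gap: the
   thesis' own mechanism «Gaussian domination pinned by gap» predicts `¬`(K2's conclusion).  Typed:
   `H_m := MassiveGaussianDominatedGappedScheme → SkewedGappedScheme → ¬ CF`, and with K1 `→ ¬ K2`
   (`skewnessNonGeneration_false_of_massiveGaussianDominated`) — a located objection, deliberately NOT filed
   `--negative-modulo` (`H_m` contains `HasLatticeMassGap` at `β → ∞`; no hold intended).  Combined with
   item 8: no known model, free or interacting, gapped as K2 requires, satisfies K2's conclusion; any proof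
   of K2 must produce exact NON-Gaussian cancellation of the mass-insertion terms.  (This also corrects
   g0's old HANDOFF remark (iii): the massless `d = 4` `F²`-skewness is identically `0`,
   `maxwellOddRing_eq_zero`; the adverse Gaussian toy is the GAPPED one.)

## HANDOFF
Landed, all ACCEPTED, axioms `propext/Classical.choice/Quot.sound`: p530625 `Negative/DilationCovariance.lean`,
p532349 `Negative/CompanionFree.lean` (g0); p540530 `Negative/ZeroCoupling.lean` (commit 81f7bc100561),
p542162 `Negative/Slices.lean` (commit 5f421462fb89), p543611 `Negative/MassiveGaussianFoil.lean` (commit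
393dc05d4ad9; bc5 seat's bytes 61c8063f0170d129), p545243 `Negative/MassiveGaussianFoilObstruction.lean`
(bc5 seat's bytes 575d7bbf850b28a5) (g1).  Sorried near-misses: none.  Pending: nothing.  Dead ends (one
line each): genuine witness needs `HasLatticeMassGap` at `β → ∞` (open); `β ≡ 0` extinct (item 6, a
theorem); fixed small `β` excluded by `hw` and by the window; trivial `G`/`ρ` excluded and extinct; rep
tricks / negative `β` concentrate at `U_p = 1` or are excluded by `hw`; no finite-volume loophole (`S`
ranges over all `S ≥ L_k`); `U(1)`/`ℤ₂` not admissible (`SU(2)` hard-wired) and fail gap or window; tree RP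
(`wilsonExpectation_reflectionPositive`) is even-side link reflection, the scheme tori are odd — `T_k ≥ 0`
is not available, hence item 3 is stated with `≤ 0`; `H → ¬K2` with `H` short of the consensus: none
honest (item 9) — the Gaussian-level `H_m` (item 11) is filed as a located objection, not a hold.  Next for
a successor (only if the route wakes — it is DORMANT and no line is picked): (i) if a line is picked, attack
`stub_twoPointMaxwellLower`'s disjunct shape with item 3 and the dilation identity (its `a_k^8 β_k^{-2}`
normalisation is the companion-covariant one) and `stub_bareSkewnessNonGeneration` with item 11's
sign-definite Gaussian prediction; (ii) a kernel-checked `T_k(u) ≥ 0` needs site-reflection RP on odd tori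
— a Literature gap worth a fact request, not a refutation; (iii) the `lint.theses-cone` warning on the
route-dependent Negative modules becomes a refusal once `theses_cone_lint=refuse` — new files should import
`MassiveGaussianFoil`/`TreeLevelSkewnessVanishes`-style route-independent modules where possible.
-/

noncomputable section

open scoped SchwartzMap Topology BigOperators
open MeasureTheory Filter Set
open Literature.MathematicalPhysics.AQFT Literature.MathematicalPhysics.QuantumLattice
open Literature.MathematicalPhysics.QuantumFieldTheory
open Summit.QuantumFields.YangMills.Theorems.SelfNormalisedSkewness.Negative
open Summit.QuantumFields.YangMills.Theorems.SkewnessNonGeneration.Negative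

namespace Summit.QuantumFields.YangMills.Cruxes.SkewnessNonGeneration.Disproof

open Summit.QuantumFields.YangMills.Theses.BoundedSkewnessRunning

/-! ## (a)–(c) Landed content (imported): dilation covariance, collapse, companion-free form

The v1/v2 sections are now the tree modules `…SkewnessNonGeneration.Negative.DilationCovariance`
(`smearedLatticeField_dilate`, `latticeSchwinger_cruxBare_companion`, `cruxT_companion`,
`cruxKappa3_companion`, `tendsto_cruxKappa3_of_constRatio`, `cruxKappa3_eq_zero_of_cruxT_nonpos`,
`tendsto_cruxKappa3_of_eventually_cruxT_nonpos`, admissibility of dilated data) and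
`…Negative.CompanionFree` (`SkewnessNonGenerationCF`, `skewnessNonGeneration_iff_CF`,
`SkewedGappedScheme`, `not_skewnessNonGeneration_iff`).  Two re-derivations for the record: -/

section Landed

variable {G : Type} [Group G] [TopologicalSpace G] [IsTopologicalGroup G] [CompactSpace G]
  [MeasurableSpace G] [BorelSpace G]

/-- Item 1: dilation invariance of `κ₃^canon` (landed `Negative.cruxKappa3_companion`). -/
example (r : LatticeRep G) {sch sch' : SpeciesScheme (YMSpecies G)} (hβ : sch'.β = sch.β)
    (hL : sch'.L = sch.L) (k : ℕ) {s : ℝ} (hs : s ≠ 0) (hsk : sch'.a k = s * sch.a k)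
    (u f g h : 𝓢(E4, ℝ)) :
    cruxKappa3 r sch u f g h k = cruxKappa3 r sch' (dilateTest s hs u) (dilateTest s hs f)
      (dilateTest s hs g) (dilateTest s hs h) k :=
  cruxKappa3_companion r hβ hL k hs hsk u f g h

/-- Item 4: modulo K1, `¬ K2 ⟺ SkewedGappedScheme` (landed `Negative.not_skewnessNonGeneration_iff`). -/
example (hK1 : UVSkewnessExtinction) : ¬ SkewnessNonGeneration ↔ SkewedGappedScheme :=
  not_skewnessNonGeneration_iff hK1

end Landed

section ConstRatio

/-- **K2 restricted to constant-ratio companions** (`a'_k = C a_k`): K2 verbatim with one extra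
hypothesis.  It is a THEOREM of the extinction hypothesis alone (`tendsto_cruxKappa3_of_constRatio`);
`κ`, weak coupling, `Δ`, the gap, the window, `a ≤ a'` and the UV window are all unused — the
kernel-checked form of "all content of K2 is the regime `a_k / a'_k → 0`". -/
theorem skewnessNonGeneration_constRatio :
    ∀ κ : ℕ, 1 ≤ κ → ∀ (r : LatticeRep (Matrix.specialUnitaryGroup (Fin 2) ℂ))
      (sch sch' : SpeciesScheme (YMSpecies (Matrix.specialUnitaryGroup (Fin 2) ℂ)))
      (u : 𝓢(E4, ℝ)) (M Δ : ℝ), sch.HasWeakCouplingLimit → 0 < Δ → HasLatticeMassGap r sch Δ →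
      HasCompactSupport (u : E4 → ℝ) → tsupport (u : E4 → ℝ) ⊆ {y : E4 | y 0 < 0} →
      (∀ᶠ k in atTop, cruxT r sch u k ≤ M * cruxT r sch (timeShiftTest 4 (-1) u) k) →
      sch'.β = sch.β → sch'.L = sch.L → (∀ k, sch.a k ≤ sch'.a k) →
      (∀ᶠ k in atTop, (sch'.a k)⁻¹ ≤ (sch'.β k) ^ κ) →
      (∀ (u' f g h : 𝓢(E4, ℝ)), HasCompactSupport (u' : E4 → ℝ) →
        tsupport (u' : E4 → ℝ) ⊆ {y : E4 | y 0 < 0} → HasCompactSupport (f : E4 → ℝ) →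
        HasCompactSupport (g : E4 → ℝ) → HasCompactSupport (h : E4 → ℝ) →
        Disjoint (tsupport (f : E4 → ℝ)) (tsupport (g : E4 → ℝ)) →
        Disjoint (tsupport (f : E4 → ℝ)) (tsupport (h : E4 → ℝ)) →
        Disjoint (tsupport (g : E4 → ℝ)) (tsupport (h : E4 → ℝ)) →
        Tendsto (cruxKappa3 r sch' u' f g h) atTop (𝓝 0)) →
      -- the extra hypothesis: constant ratio
      (∃ C : ℝ, 0 < C ∧ ∀ k, sch'.a k = C * sch.a k) →
      ∀ (f g h : 𝓢(E4, ℝ)), HasCompactSupport (f : E4 → ℝ) → HasCompactSupport (g : E4 → ℝ) →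
        HasCompactSupport (h : E4 → ℝ) → Disjoint (tsupport (f : E4 → ℝ)) (tsupport (g : E4 → ℝ)) →
        Disjoint (tsupport (f : E4 → ℝ)) (tsupport (h : E4 → ℝ)) →
        Disjoint (tsupport (g : E4 → ℝ)) (tsupport (h : E4 → ℝ)) →
        Tendsto (cruxKappa3 r sch u f g h) atTop (𝓝 0) := by
  intro _ _ r sch sch' u _ _ _ _ _ huc hup _ hβ hL _ _ hext hC f g h hf hg hh hfg hfh hgh
  obtain ⟨C, hCpos, hratio⟩ := hC
  exact tendsto_cruxKappa3_of_constRatio r hβ hL hCpos hratio hext huc hup hf hg hh hfg hfh hgh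

end ConstRatio

/-! ## (d)–(f), (g) Landed content (imported): slices, weak coupling, zero coupling, calibre, foil

One `example` per docblock item, each closed by the tree name it indexes. -/

section LandedG1

open MassiveGaussianFoil

/-- Item 5: `K2 ↔ ∀ κ ≥ 1, K2_κ` (definitional) and, modulo K1, every slice is already K2. -/
example : SkewnessNonGeneration ↔ ∀ κ : ℕ, 1 ≤ κ → SkewnessNonGenerationAt κ :=
  skewnessNonGeneration_iff_forall_at

example (hK1 : UVSkewnessExtinction) : SkewnessNonGenerationAt 1 ↔ SkewnessNonGeneration :=
  skewnessNonGenerationAt_iff hK1 le_rfl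

/-- Item 5: the slices are antitone in the exponent (a larger `κ` admits more companions). -/
example {κ κ' : ℕ} (h : κ ≤ κ') (hK : SkewnessNonGenerationAt κ') : SkewnessNonGenerationAt κ :=
  skewnessNonGenerationAt_anti h hK

/-- Item 6: on odd slices the companion window alone forces weak coupling (`hw` is decoration). -/
example {ι : Type} {κ : ℕ} (hκ : Odd κ) {sch sch' : SpeciesScheme ι} (hβ : sch'.β = sch.β)
    (hUV : ∀ᶠ k in atTop, (sch'.a k)⁻¹ ≤ (sch'.β k) ^ κ) : sch.HasWeakCouplingLimit :=
  hasWeakCouplingLimit_of_companion_odd hκ hβ hUV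

/-- Item 6: on the even slice `κ = 2` the window does NOT force weak coupling (`β_k = -(k+1)`). -/
example (ι : Type) : ∃ sch : SpeciesScheme ι,
    (∀ᶠ k in atTop, (sch.a k)⁻¹ ≤ (sch.β k) ^ 2) ∧ ¬ sch.HasWeakCouplingLimit :=
  exists_evenWindow_not_hasWeakCouplingLimit ι

/-- Item 6: the zero-coupling model is EXTINCT — `T_k(u) = 0` for past-supported `u` at `β_k = 0`. -/
example {G : Type} [Group G] [TopologicalSpace G] [IsTopologicalGroup G] [CompactSpace G]
    [MeasurableSpace G] [BorelSpace G] (r : LatticeRep G) (sch : SpeciesScheme (YMSpecies G))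
    {w : 𝓢(E4, ℝ)} (hw : tsupport (w : E4 → ℝ) ⊆ {y : E4 | y 0 < 0}) {k : ℕ} (hβ : sch.β k = 0)
    (hk : 2 < sch.side k) : cruxT r sch w k = 0 :=
  cruxT_eq_zero_of_beta_zero r sch hw hβ hk

/-- Item 6: `β ≡ 0` meets every hypothesis of K2 but `hw` (gap ∀Δ, window ∀M) AND its conclusion. -/
example {G : Type} [Group G] [TopologicalSpace G] [IsTopologicalGroup G] [CompactSpace G]
    [MeasurableSpace G] [BorelSpace G] (r : LatticeRep G) (sch : SpeciesScheme (YMSpecies G))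
    (hβ : ∀ k, sch.β k = 0) :
    (∀ Δ : ℝ, HasLatticeMassGap r sch Δ) ∧
    (∀ (u : 𝓢(E4, ℝ)) (M : ℝ), tsupport (u : E4 → ℝ) ⊆ {y : E4 | y 0 < 0} →
      ∀ᶠ k in atTop, cruxT r sch u k ≤ M * cruxT r sch (timeShiftTest 4 (-1) u) k) ∧
    (∀ (u f g h : 𝓢(E4, ℝ)), tsupport (u : E4 → ℝ) ⊆ {y : E4 | y 0 < 0} →
      Tendsto (cruxKappa3 r sch u f g h) atTop (𝓝 0)) :=
  zeroCoupling_meets_K2_sans_weakCoupling r sch hβ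

/-- Item 7 (calibre): `¬ K2` contains a weakly coupled, uniformly gapped `SU(2)` Wilson scheme. -/
example (hK : ¬ SkewnessNonGeneration) :
    ∃ (r : LatticeRep (Matrix.specialUnitaryGroup (Fin 2) ℂ))
      (sch : SpeciesScheme (YMSpecies (Matrix.specialUnitaryGroup (Fin 2) ℂ))) (Δ : ℝ),
      sch.HasWeakCouplingLimit ∧ 0 < Δ ∧ HasLatticeMassGap r sch Δ :=
  exists_weakCouplingGap_of_not_skewnessNonGeneration hK

/-- Item 11 (massive Gaussian foil): the collinear odd ring of a gapped Gaussian 2-form is `< 0`. -/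
example {α₁ γ₁ α₂ γ₂ α₃ γ₃ : ℝ} (hα₁ : α₁ ≤ 0) (hα₂ : α₂ ≤ 0) (hα₃ : α₃ ≤ 0)
    (ht₁ : 0 < 4 * α₁ + γ₁) (ht₂ : 0 < 4 * α₂ + γ₂) (ht₃ : 0 < 4 * α₃ + γ₃) :
    (K (axisHess α₁ γ₁) * K (axisHess α₂ γ₂) * K (axisHess α₃ γ₃)).trace < 0 :=
  axisOddRing_neg hα₁ hα₂ hα₃ ht₁ ht₂ ht₃

/-- Item 11: three pure-mass insertions, `tr K(𝟙)³ = -48` — a gap turns the skewness on. -/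
example : (K (1 : Matrix (Fin 4) (Fin 4) ℝ) * K 1 * K 1).trace = -48 := trace_K_one_cube

/-- Item 11 (typed obstruction): massive-Gaussian domination at scale `ξ` refutes K2, given K1. -/
example (hK1 : UVSkewnessExtinction) (H : MassiveGaussianDominatedGappedScheme) :
    ¬ SkewnessNonGeneration :=
  skewnessNonGeneration_false_of_massiveGaussianDominated hK1 H

end LandedG1

/-! ## Targets

No line has been picked for this crux (plan-only BC3 stubs `stub_twoPointMaxwellLower`,
`stub_bareSkewnessNonGeneration`, `stub_canonBareScaling`; route dormant since 2026-08-27T13:03Z);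
none is refuted here — see the module docblock, item 10.  The dilation identities (item 1) are the
tool for attacking `stub_bareSkewnessNonGeneration` once a skeleton fixes its normalisation, and the
collapse/zero-coupling lemmas (items 3, 6) bound what `stub_twoPointMaxwellLower`'s first disjunct
(`∀ k, T_k ≤ 0`) can be used for. -/

end Summit.QuantumFields.YangMills.Cruxes.SkewnessNonGeneration.Disproof

end
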